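import Literature.AlgebraicGeometry.ShimuraVarieties.UnitaryCurveAuxiliaryFormRescaling
import HarnessLib

/-!
# The Siegel chart of the unitary Shimura curve with movers AND the carrier classification clause (U3-D3)

Topic `AlgebraicGeometry/ShimuraVarieties`; namespace `Literature.AlgebraicGeometry.ShimuraVarieties.UnitaryCurve`.  THEOREMS ONLY (no `def`, no named
fact, no instance, no notation, no `sorry`).  Cell `hodgecm-mathlib` (D-0151), FLOOR 0, P6 «MOD programme», door (E) of `stub_RGD`, E-line `F0_P6a_PELWitnessE`
(`stub_E123`).  `--supports stmt-HodgeConjecture-24832`, count-neutral; HC_CM is proved only modulo the printed citations until rung 0 closes.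

THE POINT.  ★ E3 FILE D `exists_siegelChartGS_mover` hides the uniformisation `(Sc, ιc, unif, u, rep, pts)` it chose behind an `∃` and exports the
(U3-D3) classification only AT IMAGE POINTS of the point map `f`.  The reciprocity glue of the E-line (★ `F0P6aSpecialPairRecipOfChart.exists_sliceField_f_recip`,
E3R-S ∘ E3R-U) needs the classification ON THE WHOLE CARRIER of each piece — its binder `hD3 : ∀ c W hW P', IsAdmissibleAt hδ (rep c) W hW P' →
ιc_c (unif_c W) = (𝓜.classifyingMap P')_ℂ` — for THE SAME uniformisation.  This file re-exports the chart with that clause (it is clause (U3-D3) of the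
(U) fact ★ `siegelModuli_complexUniformisation` at the chart's own `(u c, rep c)`), in the general Hodge-embedding datum (§1) and at Deligne's `J_Φ` with the
E-line's signature datum for `t • J⋆` (§2, over ★ `UnitaryCurveAuxiliaryFormRescaling`).

* §1 `exists_siegelChartGS_mover_classified` — ★ `exists_siegelChartGS_mover`, conclusion VERBATIM, plus the final conjunct (D3); same proof (★ FILE D §2
  `exists_moduliPointMapGS_mover` over the (U) pieces).
* §2 `exists_siegelChartGS_auxComplexStructureV_mover_classified_of_sigDatum` — ★ `exists_siegelChartGS_auxComplexStructureV_mover_of_sigDatum`,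
  conclusion VERBATIM, plus (D3).

## References
* [MumfordFogartyKirwan1994] D. Mumford, J. Fogarty, F. Kirwan, *Geometric Invariant Theory* (3rd ed. 1994), Appendix to Ch. 7 §A pp. 234–235.
* [Deligne1971TravauxShimura] P. Deligne, *Travaux de Shimura* (1971), Prop. 1.15 p. 132, 4.11–4.12 pp. 148–149, Exemple 4.16 p. 150.
* [Deligne1979ShimuraVarieties] P. Deligne, *Variétés de Shimura* (1979), Prop. 2.3.10 (PDF p. 32 of Milne's translation).
* [Milne2005ShimuraVarieties] J. S. Milne, *Introduction to Shimura varieties* (2005), Lemma 5.13 p. 57, Thm. 6.11 p. 74, (63) p. 116.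
* [RapoportSmithlingZhang2020Diagonal] M. Rapoport, B. Smithling, W. Zhang (2020), §3.2 and Prop. 3.7 (proof) pp. 11–14.
-/

set_option autoImplicit false

noncomputable section

open Function Matrix NumberField IsDedekindDomain CategoryTheory CategoryTheory.Limits AlgebraicGeometry
open scoped Matrix ComplexOrder TensorProduct
open Literature.AlgebraicGeometry.Motives (SchemeOver ComplexPoints AlgPoints specOver CMType)
open Literature.AlgebraicGeometry.AbelianSchemes (PolarizedAbelianSchemeWithLevel)
open Literature.NumberTheory.Automorphic (siegelUpperHalfSpace)
open Literature.NumberTheory.Automorphic.UnitaryGroup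
open Literature.AlgebraicGeometry.ModuliOfAbelianVarieties
open Literature.AlgebraicGeometry.ModuliOfAbelianVarieties.SiegelModuli (C0 mem_C0_iff jOfSiegel jOfSiegel_mem_C0)

namespace Literature.AlgebraicGeometry.ShimuraVarieties

open UnitaryCanonicalModel
open Literature.AlgebraicGeometry.ShimuraVarieties.UnitaryCurve.AuxV

namespace UnitaryCurve

variable {L : Type} [Field L] [NumberField L] [IsCMField L] {Jstar : Matrix (Fin 2) (Fin 2) L} {τ : L →+* ℂ}
variable {g : ℕ} {δ : Fin g → ℕ} {N : ℕ}

/-! ### §1. The general datum -/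

section Chart

variable (J : (Fin 2 → ℂ) → Matrix (Fin g ⊕ Fin g) (Fin g ⊕ Fin g) ℝ)
  (hJ : ∀ v : Fin 2 → ℂ, v ∈ negCone (Jstar.map τ) → J v ∈ C0pm δ)
  (b : ↥(finAdelic (↥(maximalRealSubfield L)) L (IsCMField.complexConj L) 2 Jstar) →* ↥(gspFinAdelic δ))
  (bq : ↥(rational (↥(maximalRealSubfield L)) L (IsCMField.complexConj L) 2 Jstar) →* ↥(gspRational δ))

/-- **THE SIEGEL CHART WITH MOVERS AND CARRIER CLASSIFICATION** — ★ `exists_siegelChartGS_mover` (all clauses verbatim: pieces, uniformisations, `f`,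
`piece`, `Z`, principal representatives, `pts`, `f_mk`, shadow, admissibility and classification at image points, movers (Q)) plus (D3): on every piece
`c` and every `W ∈ 𝔥_g`, every triple admissible for `(W, rep c)` is classified by `ιc_c (unif_c W)` (★ (U3-D3) of `siegelModuli_complexUniformisation`).
[cite: MumfordFogartyKirwan1994, Appendix to Ch. 7 §A pp. 234–235] [cite: Deligne1971TravauxShimura, Prop. 1.15 p. 132, 4.11–4.12, Exemple 4.16 p. 150]
[cite: Deligne1979ShimuraVarieties, Prop. 2.3.10] [cite: Milne2005ShimuraVarieties, Lemma 5.13 p. 57, Thm. 6.11 p. 74 and (63) p. 116] -/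
theorem exists_siegelChartGS_mover_classified (hU : siegelModuli_complexUniformisation) (hg : 0 < g) (hδ : IsPolarizationType δ) (hN : 3 ≤ N)
    (𝓜 : SiegelFineModuliScheme g N δ)
    (hJneg : ∀ v : Fin 2 → ℂ, v ∈ negCone (Jstar.map τ) → -J v ∈ C0 δ)
    (hJsmul : ∀ c : ℂ, c ≠ 0 → ∀ v : Fin 2 → ℂ, v ∈ negCone (Jstar.map τ) → J (c • v) = J v)
    (hb : ∀ γ : ↥(rational (↥(maximalRealSubfield L)) L (IsCMField.complexConj L) 2 Jstar),
      b (rationalToFinAdelic (↥(maximalRealSubfield L)) L (IsCMField.complexConj L) 2 Jstar γ) = gspRationalToFinAdelic δ (bq γ))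
    (hJrat : ∀ (γ : ↥(rational (↥(maximalRealSubfield L)) L (IsCMField.complexConj L) 2 Jstar)) (v : Fin 2 → ℂ),
      v ∈ negCone (Jstar.map τ) →
        J (((ratToGLℂ L Jstar τ γ : GL (Fin 2) ℂ) : Matrix (Fin 2) (Fin 2) ℂ) *ᵥ v) =
          conjJ ((gspRationalToReal δ (bq γ) : ↥(gspReal δ)) : GL (Fin g ⊕ Fin g) ℝ) (J v))
    (K : Subgroup ↥(finAdelic (↥(maximalRealSubfield L)) L (IsCMField.complexConj L) 2 Jstar))
    (hle : K ≤ (principalLevelSubgroup δ N).comap b)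
    (hZ : ∀ γ : GL (Fin g ⊕ Fin g) ℝ, γ ∈ gspReal δ → (∀ v : Fin 2 → ℂ, v ∈ negCone (Jstar.map τ) → conjJ γ (J v) ∈ C0 δ) →
      ∃ Z : (Fin 2 → ℂ) → Matrix (Fin g) (Fin g) ℂ,
        (∀ i j : Fin g, DifferentiableOn ℂ (fun v => Z v i j) (negCone (Jstar.map τ))) ∧
          ∀ v : Fin 2 → ℂ, v ∈ negCone (Jstar.map τ) → Z v ∈ siegelUpperHalfSpace g ∧ conjJ γ (J v) = jOfSiegel δ (Z v)) :
    haveI : IsLocallyNoetherian (specOver ℚ ℂ).left := inferInstanceAs (IsLocallyNoetherian (Spec (CommRingCat.of ℂ)))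
    ∃ (Sc : (ZMod N)ˣ → SchemeOver ℂ) (ιc : ∀ c, Sc c ⟶ (Motives.baseChange ℚ ℂ).obj 𝓜.M)
      (unif : ∀ _c : (ZMod N)ˣ, Matrix (Fin g) (Fin g) ℂ → ComplexPoints (Sc _c))
      (f : ShimuraSetGS L Jstar τ K → ComplexPoints 𝓜.M)
      (piece : ↥(finAdelic (↥(maximalRealSubfield L)) L (IsCMField.complexConj L) 2 Jstar) → (ZMod N)ˣ)
      (Z : ↥(finAdelic (↥(maximalRealSubfield L)) L (IsCMField.complexConj L) 2 Jstar) → (Fin 2 → ℂ) → Matrix (Fin g) (Fin g) ℂ)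
      (u : (ZMod N)ˣ → finAdeleQˣ) (rep : (ZMod N)ˣ → ↥(gspFinAdelic δ))
      (pts : ComplexPoints ((Motives.baseChange ℚ ℂ).obj 𝓜.M) ≃ SiegelShimuraSet δ (principalLevelSubgroup δ N))
      (q : ↥(finAdelic (↥(maximalRealSubfield L)) L (IsCMField.complexConj L) 2 Jstar) → ↥(gspRational δ)),
    -- (U1) component cofan of irreducible pieces
      Nonempty (IsColimit (Cofan.mk ((Motives.baseChange ℚ ℂ).obj 𝓜.M) ιc)) ∧
      (∀ c, IrreducibleSpace (Sc c).left) ∧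
    -- (U2+) analytic clauses per piece
      (∀ c, ContinuousOn (unif c) (siegelUpperHalfSpace g)) ∧
      (∀ c, IsOpenMap ((siegelUpperHalfSpace g).restrict (unif c))) ∧
      (∀ c, Set.SurjOn (unif c) (siegelUpperHalfSpace g) Set.univ) ∧
      (∀ c, ∀ W ∈ siegelUpperHalfSpace g, ∀ W' ∈ siegelUpperHalfSpace g,
        unif c W = unif c W' ↔ ∃ M ∈ siegelLevelGroup δ N, ∃ C : (Fin g → ℂ) ≃ₗ[ℂ] (Fin g → ℂ),
          ∀ x : Fin g ⊕ Fin g → ℝ, C (siegelPeriodMap δ W x) = siegelPeriodMap δ W' (intAct M x)) ∧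
      (∀ (c : (ZMod N)ˣ) (U : (Sc c).left.affineOpens) (s : (Sc c).left.presheaf.obj (Opposite.op (↑U : (Sc c).left.Opens))),
        DifferentiableOn ℂ (fun W ↦ AlgPoints.evalOrZero (↑U : (Sc c).left.Opens) s (unif c W))
          (siegelUpperHalfSpace g ∩ unif c ⁻¹' {P | P.pt ∈ (↑U : (Sc c).left.Opens)})) ∧
    -- principal representatives (the five (U3) premisses)
      (∀ c, (∀ w, Valued.v ((u c : finAdeleQ) w) = 1) ∧ (u c : finAdeleQ) - ((c : ZMod N).val : ℕ) ∈ levelIdeal N ∧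
        rep c ∈ principalLevelSubgroup δ 1 ∧
          IsMultiplier (typeFormOver δ finAdeleQ) (rep c : GL (Fin g ⊕ Fin g) finAdeleQ) (u c) ∧
            ((rep c : GL (Fin g ⊕ Fin g) finAdeleQ) : Matrix (Fin g ⊕ Fin g) (Fin g ⊕ Fin g) finAdeleQ) =
              Matrix.fromBlocks 1 0 0 ((u c : finAdeleQ) • (1 : Matrix (Fin g) (Fin g) finAdeleQ))) ∧
    -- (P) the point map: `Z_hol`, `Z_mem`, `f_mk`, the Shimura-set shadow
      (∀ a (i j : Fin g), DifferentiableOn ℂ (fun v => Z a v i j) (negCone (Jstar.map τ))) ∧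
      (∀ a (v : Fin 2 → ℂ), v ∈ negCone (Jstar.map τ) → Z a v ∈ siegelUpperHalfSpace g) ∧
      (∀ (v : Fin 2 → ℂ) (hv : v ∈ negCone (Jstar.map τ)) a,
        f (ShimuraSetGS.mk L Jstar τ K v hv a) =
          (AlgPoints.baseChangeEquiv (algebraMap ℚ ℂ) 𝓜.M).symm (AlgPoints.map (ιc (piece a)) (unif (piece a) (Z a v)))) ∧
      (∀ (v : Fin 2 → ℂ) (hv : v ∈ negCone (Jstar.map τ)) a,
        pts (AlgPoints.baseChangeEquiv (algebraMap ℚ ℂ) 𝓜.M (f (ShimuraSetGS.mk L Jstar τ K v hv a))) =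
          SiegelShimuraSet.mk δ (principalLevelSubgroup δ N) ⟨J v, hJ v hv⟩ (b a)) ∧
      (∀ (v : Fin 2 → ℂ) (hv : v ∈ negCone (Jstar.map τ)) a, ∃ hZv : Z a v ∈ siegelUpperHalfSpace g,
        SiegelShimuraSet.mk δ (principalLevelSubgroup δ N) ⟨J v, hJ v hv⟩ (b a) =
          SiegelShimuraSet.mk δ (principalLevelSubgroup δ N)
            ⟨jOfSiegel δ (Z a v), C0_subset_C0pm δ (jOfSiegel_mem_C0 hδ.1 hZv)⟩ (rep (piece a))) ∧
      (∀ (c : (ZMod N)ˣ) (W : Matrix (Fin g) (Fin g) ℂ) (hW : W ∈ siegelUpperHalfSpace g),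
        pts (AlgPoints.map (ιc c) (unif c W)) =
          SiegelShimuraSet.mk δ (principalLevelSubgroup δ N) ⟨jOfSiegel δ W, C0_subset_C0pm δ (jOfSiegel_mem_C0 hδ.1 hW)⟩ (rep c)) ∧
    -- (A) admissibility of the universal triple at the image point ((U3∃)) and classification ((U3-D3))
      (∀ (v : Fin 2 → ℂ) (hv : v ∈ negCone (Jstar.map τ)) a, ∃ hZv : Z a v ∈ siegelUpperHalfSpace g,
        (∃ (P' : PolarizedAbelianSchemeWithLevel g N δ (specOver ℚ ℂ).left)
            (G : P'.A.X.left ⟶ 𝓜.univ.A.X.left) (Ĝ : P'.D.hat.X.left ⟶ 𝓜.univ.D.hat.X.left),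
            P'.IsBaseChangeVia 𝓜.univ (f (ShimuraSetGS.mk L Jstar τ K v hv a)).left G Ĝ ∧
              IsAdmissibleAt hδ (rep (piece a)) (Z a v) hZv P') ∧
        ∀ P' : PolarizedAbelianSchemeWithLevel g N δ (specOver ℚ ℂ).left, IsAdmissibleAt hδ (rep (piece a)) (Z a v) hZv P' →
          f (ShimuraSetGS.mk L Jstar τ K v hv a) = 𝓜.classifyingMap (specOver ℚ ℂ) P') ∧
    -- (Q) THE MOVERS
      (∀ (v : Fin 2 → ℂ), v ∈ negCone (Jstar.map τ) → ∀ a,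
        conjJ (((gspRationalToReal δ (q a))⁻¹ : ↥(gspReal δ)) : GL (Fin g ⊕ Fin g) ℝ) (J v) = jOfSiegel δ (Z a v) ∧
          gspRationalToFinAdelic δ (q a) • ((rep (piece a) : gspFinAdelic δ) : gspFinAdelic δ ⧸ principalLevelSubgroup δ N) =
            ((b a : gspFinAdelic δ) : gspFinAdelic δ ⧸ principalLevelSubgroup δ N)) ∧
    -- (D3) CARRIER CLASSIFICATION on every piece (★ (U3-D3) at the chart's own uniformisation; the `hD3` binder of the reciprocity glue)
      (∀ (c : (ZMod N)ˣ) (W : Matrix (Fin g) (Fin g) ℂ) (hW : W ∈ siegelUpperHalfSpace g)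
        (P' : PolarizedAbelianSchemeWithLevel g N δ (specOver ℚ ℂ).left), IsAdmissibleAt hδ (rep c) W hW P' →
          AlgPoints.map (ιc c) (unif c W) =
            AlgPoints.baseChangeEquiv (algebraMap ℚ ℂ) 𝓜.M (𝓜.classifyingMap (specOver ℚ ℂ) P')) := by
  classical
  -- the clauses of (U) at `𝓜`
  obtain ⟨Sc, ιc, unif, ⟨hc⟩, hirr, hU2, hU3⟩ := hU g N δ hg hδ hN 𝓜
  have hsurj : ∀ c, Set.SurjOn (unif c) (siegelUpperHalfSpace g) Set.univ := fun c => (hU2 c).2.2.1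
  have hiff : ∀ c, ∀ W ∈ siegelUpperHalfSpace g, ∀ W' ∈ siegelUpperHalfSpace g,
      unif c W = unif c W' ↔ ∃ M ∈ siegelLevelGroup δ N, ∃ C : (Fin g → ℂ) ≃ₗ[ℂ] (Fin g → ℂ),
        ∀ x : Fin g ⊕ Fin g → ℝ, C (siegelPeriodMap δ W x) = siegelPeriodMap δ W' (intAct M x) := fun c => (hU2 c).2.2.2.1
  -- ★ FILE D §2 over these pieces
  obtain ⟨f, piece, Z, u, rep, pts, q, hrep, hZd, hZm, hfmk, hptsf, hmkrep, hval, hq⟩ :=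
    exists_moduliPointMapGS_mover J hJ b bq hg hδ hN hJneg hJsmul hb hJrat K hle hZ hc unif hsurj hiff
  refine ⟨Sc, ιc, unif, fun x => (AlgPoints.baseChangeEquiv (algebraMap ℚ ℂ) 𝓜.M).symm (f x), piece, Z, u, rep, pts, q,
    ⟨hc⟩, hirr, fun c => (hU2 c).1, fun c => (hU2 c).2.1, hsurj, hiff, fun c => (hU2 c).2.2.2.2, hrep, hZd, hZm,
    fun v hv a => congrArg (AlgPoints.baseChangeEquiv (algebraMap ℚ ℂ) 𝓜.M).symm (hfmk v hv a),
    fun v hv a => by show pts (AlgPoints.baseChangeEquiv _ 𝓜.M ((AlgPoints.baseChangeEquiv _ 𝓜.M).symm (f _))) = _;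
                     rw [Equiv.apply_symm_apply, hptsf], hmkrep, hval,
    fun v hv a => ?_, hq, fun c W hW P' hP' => ?_⟩
  · -- (A) at `(piece a, u (piece a), rep (piece a))` and `Z a v`
    obtain ⟨hu1, hu2, hr1, hr2, hr3⟩ := hrep (piece a)
    have h3 := hU3 (piece a) (u (piece a)) (rep (piece a)) hu1 hu2 hr1 hr2 hr3 (Z a v) (hZm a v hv)
    refine ⟨hZm a v hv, ?_, fun P' hP' => ?_⟩
    · obtain ⟨P', G, Ĝ, hbc, hadm⟩ := h3.1
      refine ⟨P', G, Ĝ, ?_, hadm⟩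
      simp only [hfmk]
      exact hbc
    · show (AlgPoints.baseChangeEquiv (algebraMap ℚ ℂ) 𝓜.M).symm (f _) = _
      rw [Equiv.symm_apply_eq, hfmk]
      exact h3.2 P' hP'
  · -- (D3) on the carrier
    obtain ⟨hu1, hu2, hr1, hr2, hr3⟩ := hrep c
    exact (hU3 c (u c) (rep c) hu1 hu2 hr1 hr2 hr3 W hW).2 P' hP'

end Chart

/-! ### §2. At Deligne's `J_Φ` with the E-line's signature datum -/

/-- **THE SIEGEL CHART AT `J_Φ` WITH MOVERS AND CARRIER CLASSIFICATION, FROM A SIGNATURE DATUM FOR `t • J⋆`** — ★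
`exists_siegelChartGS_auxComplexStructureV_mover_of_sigDatum` (conclusion verbatim) plus (D3).  With ★ `exists_sliceField_f_recip` (binders `hu huc hmult hD3 pts
hval` = this file's `rep_spec` components, (D3), `pts_unif`) this is every input of the E-line's `AuxChartGS.f_recip`.
[cite: Deligne1979ShimuraVarieties, Prop. 2.3.10 (PDF p. 32)] [cite: Milne2005ShimuraVarieties, Lemma 5.13 p. 57, Thm. 6.11 p. 74]
[cite: RapoportSmithlingZhang2020Diagonal, Remark 3.2 (ii)(iii) pp. 9–10 and Prop. 3.7 pp. 13–14] -/
theorem exists_siegelChartGS_auxComplexStructureV_mover_classified_of_sigDatum (hU : siegelModuli_complexUniformisation) (hg : 0 < g)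
    (hδ : IsPolarizationType δ) (hN : 3 ≤ N) (𝓜 : SiegelFineModuliScheme g N δ)
    (Φ : CMType L) (hΦ : τ ∈ Φ.1) {ξ : L} (F : SymplecticFrameV L (RingHom.id L) Jstar ξ g δ)
    (hJ : (Jstar.map (IsCMField.complexConj L))ᵀ = Jstar) {t : L} (hτt : 0 < (τ t).re) (hτt' : (τ t).im = 0)
    (hξ : ∀ ρ : Φ.1, (ρ.1 (ξ * t⁻¹)).im < 0) (T : GL (Fin 2) ℂ)
    (hT : (T : Matrix (Fin 2) (Fin 2) ℂ)ᴴ * (t • Jstar).map τ * (T : Matrix (Fin 2) (Fin 2) ℂ) = signatureMatrix 1)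
    (hpos : ∀ σ : L →+* ℂ, InfinitePlace.mk σ ≠ InfinitePlace.mk τ → ((t • Jstar).map σ).PosDef)
    (K : Subgroup ↥(finAdelic (↥(maximalRealSubfield L)) L (IsCMField.complexConj L) 2 Jstar))
    (hle : K ≤ (principalLevelSubgroup δ N).comap ((auxToGspFinV F).comp (MonoidHom.inl _ _))) :
    haveI : IsLocallyNoetherian (specOver ℚ ℂ).left := inferInstanceAs (IsLocallyNoetherian (Spec (CommRingCat.of ℂ)))
    ∃ (Sc : (ZMod N)ˣ → SchemeOver ℂ) (ιc : ∀ c, Sc c ⟶ (Motives.baseChange ℚ ℂ).obj 𝓜.M)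
      (unif : ∀ _c : (ZMod N)ˣ, Matrix (Fin g) (Fin g) ℂ → ComplexPoints (Sc _c))
      (f : ShimuraSetGS L Jstar τ K → ComplexPoints 𝓜.M)
      (piece : ↥(finAdelic (↥(maximalRealSubfield L)) L (IsCMField.complexConj L) 2 Jstar) → (ZMod N)ˣ)
      (Z : ↥(finAdelic (↥(maximalRealSubfield L)) L (IsCMField.complexConj L) 2 Jstar) → (Fin 2 → ℂ) → Matrix (Fin g) (Fin g) ℂ)
      (u : (ZMod N)ˣ → finAdeleQˣ) (rep : (ZMod N)ˣ → ↥(gspFinAdelic δ))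
      (pts : ComplexPoints ((Motives.baseChange ℚ ℂ).obj 𝓜.M) ≃ SiegelShimuraSet δ (principalLevelSubgroup δ N))
      (q : ↥(finAdelic (↥(maximalRealSubfield L)) L (IsCMField.complexConj L) 2 Jstar) → ↥(gspRational δ)),
    -- (U1) component cofan of irreducible pieces
      Nonempty (IsColimit (Cofan.mk ((Motives.baseChange ℚ ℂ).obj 𝓜.M) ιc)) ∧
      (∀ c, IrreducibleSpace (Sc c).left) ∧
    -- (U2+) analytic clauses per piece
      (∀ c, ContinuousOn (unif c) (siegelUpperHalfSpace g)) ∧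
      (∀ c, IsOpenMap ((siegelUpperHalfSpace g).restrict (unif c))) ∧
      (∀ c, Set.SurjOn (unif c) (siegelUpperHalfSpace g) Set.univ) ∧
      (∀ c, ∀ W ∈ siegelUpperHalfSpace g, ∀ W' ∈ siegelUpperHalfSpace g,
        unif c W = unif c W' ↔ ∃ M ∈ siegelLevelGroup δ N, ∃ C : (Fin g → ℂ) ≃ₗ[ℂ] (Fin g → ℂ),
          ∀ x : Fin g ⊕ Fin g → ℝ, C (siegelPeriodMap δ W x) = siegelPeriodMap δ W' (intAct M x)) ∧
      (∀ (c : (ZMod N)ˣ) (U : (Sc c).left.affineOpens) (s : (Sc c).left.presheaf.obj (Opposite.op (↑U : (Sc c).left.Opens))),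
        DifferentiableOn ℂ (fun W ↦ AlgPoints.evalOrZero (↑U : (Sc c).left.Opens) s (unif c W))
          (siegelUpperHalfSpace g ∩ unif c ⁻¹' {P | P.pt ∈ (↑U : (Sc c).left.Opens)})) ∧
    -- principal representatives (the five (U3) premisses)
      (∀ c, (∀ w, Valued.v ((u c : finAdeleQ) w) = 1) ∧ (u c : finAdeleQ) - ((c : ZMod N).val : ℕ) ∈ levelIdeal N ∧
        rep c ∈ principalLevelSubgroup δ 1 ∧
          IsMultiplier (typeFormOver δ finAdeleQ) (rep c : GL (Fin g ⊕ Fin g) finAdeleQ) (u c) ∧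
            ((rep c : GL (Fin g ⊕ Fin g) finAdeleQ) : Matrix (Fin g ⊕ Fin g) (Fin g ⊕ Fin g) finAdeleQ) =
              Matrix.fromBlocks 1 0 0 ((u c : finAdeleQ) • (1 : Matrix (Fin g) (Fin g) finAdeleQ))) ∧
    -- (P) the point map: `Z_hol`, `Z_mem`, `f_mk`, the Shimura-set shadow
      (∀ a (i j : Fin g), DifferentiableOn ℂ (fun v => Z a v i j) (negCone (Jstar.map τ))) ∧
      (∀ a (v : Fin 2 → ℂ), v ∈ negCone (Jstar.map τ) → Z a v ∈ siegelUpperHalfSpace g) ∧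
      (∀ (v : Fin 2 → ℂ) (hv : v ∈ negCone (Jstar.map τ)) a,
        f (ShimuraSetGS.mk L Jstar τ K v hv a) =
          (AlgPoints.baseChangeEquiv (algebraMap ℚ ℂ) 𝓜.M).symm (AlgPoints.map (ιc (piece a)) (unif (piece a) (Z a v)))) ∧
      (∀ (v : Fin 2 → ℂ) (hv : v ∈ negCone (Jstar.map τ)) a,
        pts (AlgPoints.baseChangeEquiv (algebraMap ℚ ℂ) 𝓜.M (f (ShimuraSetGS.mk L Jstar τ K v hv a))) =
          SiegelShimuraSet.mk δ (principalLevelSubgroup δ N) ⟨auxComplexStructureV F τ Φ v,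
            auxComplexStructureV_mem_C0pm_of_sigDatum F Φ hΦ hJ hτt hτt' hξ T hT hpos v hv⟩ (((auxToGspFinV F).comp (MonoidHom.inl _ _)) a)) ∧
      (∀ (v : Fin 2 → ℂ) (hv : v ∈ negCone (Jstar.map τ)) a, ∃ hZv : Z a v ∈ siegelUpperHalfSpace g,
        SiegelShimuraSet.mk δ (principalLevelSubgroup δ N) ⟨auxComplexStructureV F τ Φ v,
            auxComplexStructureV_mem_C0pm_of_sigDatum F Φ hΦ hJ hτt hτt' hξ T hT hpos v hv⟩ (((auxToGspFinV F).comp (MonoidHom.inl _ _)) a) =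
          SiegelShimuraSet.mk δ (principalLevelSubgroup δ N)
            ⟨jOfSiegel δ (Z a v), C0_subset_C0pm δ (jOfSiegel_mem_C0 hδ.1 hZv)⟩ (rep (piece a))) ∧
      (∀ (c : (ZMod N)ˣ) (W : Matrix (Fin g) (Fin g) ℂ) (hW : W ∈ siegelUpperHalfSpace g),
        pts (AlgPoints.map (ιc c) (unif c W)) =
          SiegelShimuraSet.mk δ (principalLevelSubgroup δ N) ⟨jOfSiegel δ W, C0_subset_C0pm δ (jOfSiegel_mem_C0 hδ.1 hW)⟩ (rep c)) ∧
    -- (A) admissibility of the universal triple at the image point ((U3∃)) and classification ((U3-D3))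
      (∀ (v : Fin 2 → ℂ) (hv : v ∈ negCone (Jstar.map τ)) a, ∃ hZv : Z a v ∈ siegelUpperHalfSpace g,
        (∃ (P' : PolarizedAbelianSchemeWithLevel g N δ (specOver ℚ ℂ).left)
            (G : P'.A.X.left ⟶ 𝓜.univ.A.X.left) (Ĝ : P'.D.hat.X.left ⟶ 𝓜.univ.D.hat.X.left),
            P'.IsBaseChangeVia 𝓜.univ (f (ShimuraSetGS.mk L Jstar τ K v hv a)).left G Ĝ ∧
              IsAdmissibleAt hδ (rep (piece a)) (Z a v) hZv P') ∧
        ∀ P' : PolarizedAbelianSchemeWithLevel g N δ (specOver ℚ ℂ).left, IsAdmissibleAt hδ (rep (piece a)) (Z a v) hZv P' →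
          f (ShimuraSetGS.mk L Jstar τ K v hv a) = 𝓜.classifyingMap (specOver ℚ ℂ) P') ∧
    -- (Q) THE MOVERS: `Z a` is E2's period function in the frame `(q a)_ℝ⁻¹`, `q a` tied to `a` adelically
      (∀ (v : Fin 2 → ℂ), v ∈ negCone (Jstar.map τ) → ∀ a,
        conjJ (((gspRationalToReal δ (q a))⁻¹ : ↥(gspReal δ)) : GL (Fin g ⊕ Fin g) ℝ) (auxComplexStructureV F τ Φ v) = jOfSiegel δ (Z a v) ∧
          gspRationalToFinAdelic δ (q a) • ((rep (piece a) : gspFinAdelic δ) : gspFinAdelic δ ⧸ principalLevelSubgroup δ N) =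
            ((((auxToGspFinV F).comp (MonoidHom.inl _ _)) a : gspFinAdelic δ) : gspFinAdelic δ ⧸ principalLevelSubgroup δ N)) ∧
    -- (D3) CARRIER CLASSIFICATION on every piece (the `hD3` binder of the reciprocity glue)
      (∀ (c : (ZMod N)ˣ) (W : Matrix (Fin g) (Fin g) ℂ) (hW : W ∈ siegelUpperHalfSpace g)
        (P' : PolarizedAbelianSchemeWithLevel g N δ (specOver ℚ ℂ).left), IsAdmissibleAt hδ (rep c) W hW P' →
          AlgPoints.map (ιc c) (unif c W) =
            AlgPoints.baseChangeEquiv (algebraMap ℚ ℂ) 𝓜.M (𝓜.classifyingMap (specOver ℚ ℂ) P')) :=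
  exists_siegelChartGS_mover_classified (auxComplexStructureV F τ Φ)
    (auxComplexStructureV_mem_C0pm_of_sigDatum F Φ hΦ hJ hτt hτt' hξ T hT hpos)
    ((auxToGspFinV F).comp (MonoidHom.inl _ _)) ((auxToGspRatV F).comp (MonoidHom.inl _ _)) hU hg hδ hN 𝓜
    (neg_auxComplexStructureV_mem_C0_of_sigDatum F Φ hΦ hJ hτt hτt' hξ T hT hpos)
    (fun _ hc v _ => auxComplexStructureV_smul F τ Φ v hc) (hb_auxToGspFinV_inl F)
    (auxComplexStructureV_hJrat F τ Φ (negCone (Jstar.map τ))) K hle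
    (fun γ _ hC => periodChartV L F Φ τ hδ.1 γ hC)

end UnitaryCurve

end Literature.AlgebraicGeometry.ShimuraVarieties

end
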